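import Summits.Ventures.PercRepro.Night2LocalD2FarTriangle

/-!
# PercRepro — at most three far preimages, at most twelve pair preimages (night-2, gen 15)

The counts behind the pair-5 column bound of the `k = 0` cell (NIGHT-2-k0.md), under the hypothesis (H4) that every
`C ⊆ G` with `|C| ≤ 4` has `ρ(G ∖ C) ≥ 3`:

* `card_opFarPre_le_three` — a shadow set `S` has at most three far preimages: three of them form a triangle
  `T = Z₁ ∪ Z₂ ∪ Z₃` (`card_union_three_far_eq_three`), every further far pair lies in `Z₁ ∪ Z₂ ⊆ T`
  (`sdiff_clF_subset_union_of_two_far`), and the far pairs are distinct 2-subsets of the 3-set `T`.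
* `card_pairPre_le_twelve_of_three_far` — at a triangle, `S` has at most `12` pair preimages: the pair `P = S ∖ B'`
  of a pair preimage meets `T` (`not_sdiff_subset_inter_of_two_far`); either `P ⊆ T` (three pairs) or `P = {t, x}`
  with `t ∈ T` and `x ∈ N := S ∖ T` a COLOOP of `N` (submodularity of `B'` and `Π := G ∖ T`: `ρ(Π) ≤ 3`,
  `ρ(G ∖ t) = 5`, so `ρ(N ∖ x) ≤ 2 < 3 = ρ(N)`); `N` has rank `3`, hence at most three coloops: `3 + 3·3 = 12`.
-/

namespace PercRepro.Shadow

open Finset PerFlat ThmH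

variable {α : Type*} [DecidableEq α] {M : Matroid α} [M.Finite]

/-! ## Far preimages -/

open scoped Classical in
/-- Under (H4), every far pair of `S` lies in `Z₁ ∪ Z₂` once two distinct far preimages `B₁ ≠ B₂` are given. -/
theorem sdiff_clF_subset_union_of_two_far {G : Finset α} (hG : G ∈ flatsQ M (4 + 1)) (hd : (gr M \ G).card = 2)
    (h4 : ∀ C ⊆ G, C.card ≤ 4 → 3 ≤ rkN M (G \ C))
    {S B₁ B₂ : Finset α} (h₁ : B₁ ∈ opFarPre M G S) (h₂ : B₂ ∈ opFarPre M G S) (h₁₂ : B₁ ≠ B₂)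
    {B : Finset α} (hB : B ∈ opFarPre M G S) : G \ clF M B ⊆ (G \ clF M B₁) ∪ (G \ clF M B₂) := by
  by_cases hB₁ : B = B₁
  · subst hB₁; exact Finset.subset_union_left
  by_cases hB₂ : B = B₂
  · subst hB₂; exact Finset.subset_union_right
  have h3 := card_union_three_far_eq_three hG hd h4 h₁ h₂ hB h₁₂ (Ne.symm hB₁) (Ne.symm hB₂)
  have hc₁ := (mem_opFarPre.1 h₁).2.1
  have hc₂ := (mem_opFarPre.1 h₂).2.1
  have hZne := sdiff_clF_ne_of_opFarPre h₁ h₂ h₁₂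
  have h12 : ((G \ clF M B₁) ∪ (G \ clF M B₂)).card + ((G \ clF M B₁) ∩ (G \ clF M B₂)).card = 4 := by
    rw [Finset.card_union_add_card_inter, hc₁, hc₂]
  have hint : ((G \ clF M B₁) ∩ (G \ clF M B₂)).card ≤ 1 := by
    by_contra hcon
    push Not at hcon
    have e₁ : (G \ clF M B₁) ∩ (G \ clF M B₂) = G \ clF M B₁ :=
      Finset.eq_of_subset_of_card_le Finset.inter_subset_left (by omega)
    have e₂ : (G \ clF M B₁) ∩ (G \ clF M B₂) = G \ clF M B₂ :=
      Finset.eq_of_subset_of_card_le Finset.inter_subset_right (by omega)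
    exact hZne (e₁.symm.trans e₂)
  have heq : (G \ clF M B₁) ∪ (G \ clF M B₂) = (G \ clF M B₁) ∪ (G \ clF M B₂) ∪ (G \ clF M B) :=
    Finset.eq_of_subset_of_card_le Finset.subset_union_left (by omega)
  rw [heq]
  exact Finset.subset_union_right

open scoped Classical in
/-- **At most three far preimages** under (H4). -/
theorem card_opFarPre_le_three {G : Finset α} (hG : G ∈ flatsQ M (4 + 1)) (hd : (gr M \ G).card = 2)
    (h4 : ∀ C ⊆ G, C.card ≤ 4 → 3 ≤ rkN M (G \ C)) (S : Finset α) : (opFarPre M G S).card ≤ 3 := by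
  by_cases hlt : 2 < (opFarPre M G S).card
  · obtain ⟨B₁, h₁, B₂, h₂, B₃, h₃, h₁₂, h₁₃, h₂₃⟩ := Finset.two_lt_card.1 hlt
    have hT := card_union_three_far_eq_three hG hd h4 h₁ h₂ h₃ h₁₂ h₁₃ h₂₃
    have hmaps : ∀ B ∈ opFarPre M G S,
        G \ clF M B ∈ Finset.powersetCard 2 ((G \ clF M B₁) ∪ (G \ clF M B₂) ∪ (G \ clF M B₃)) := by
      intro B hB
      rw [Finset.mem_powersetCard]
      exact ⟨(sdiff_clF_subset_union_of_two_far hG hd h4 h₁ h₂ h₁₂ hB).trans Finset.subset_union_left,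
        (mem_opFarPre.1 hB).2.1⟩
    have hinj : Set.InjOn (fun B => G \ clF M B) (opFarPre M G S : Set (Finset α)) := by
      intro B hB B' hB' hBB'
      by_contra hne
      exact sdiff_clF_ne_of_opFarPre (Finset.mem_coe.1 hB) (Finset.mem_coe.1 hB') hne hBB'
    have := Finset.card_le_card_of_injOn (fun B => G \ clF M B) hmaps hinj
    rw [Finset.card_powersetCard, hT] at this
    exact this
  · push Not at hlt
    omega

/-! ## Pair preimages at a triangle -/

open scoped Classical in
/-- `ρ(G ∖ t) ≥ 5` for a point `t` of a far pair `G ∖ cl B` of `S`. -/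
theorem five_le_rkN_erase_of_mem_sdiff_clF {G : Finset α} (hG : G ∈ flatsQ M (4 + 1)) {S B : Finset α}
    (hB : B ∈ opFarPre M G S) {t : α} (ht : t ∈ G \ clF M B) : 5 ≤ rkN M (G.erase t) := by
  obtain ⟨hBm, hm, -⟩ := mem_opFarPre.1 hB
  have hBU : B ∈ Uq M (4 + 2) 4 := (mem_membersIn.1 hBm).1
  have hcl : clF M B ⊆ G := (mem_membersIn.1 hBm).2
  obtain ⟨a, b, hab, hZ⟩ := Finset.card_eq_two.1 hm
  have htab : t = a ∨ t = b := by
    rw [hZ, Finset.mem_insert, Finset.mem_singleton] at ht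
    exact ht
  obtain ⟨t', ht'Z, ht't⟩ : ∃ t' ∈ G \ clF M B, t' ≠ t := by
    rcases htab with rfl | rfl
    · exact ⟨b, by rw [hZ]; simp, hab.symm⟩
    · exact ⟨a, by rw [hZ]; simp, hab⟩
  have hsub : insert t' B ⊆ G.erase t := by
    intro e he
    rw [Finset.mem_insert] at he
    rw [Finset.mem_erase]
    rcases he with rfl | heB
    · exact ⟨ht't, (Finset.mem_sdiff.1 ht'Z).1⟩
    · refine ⟨?_, hcl (subset_clF hBU heB)⟩
      rintro rfl
      exact (Finset.mem_sdiff.1 ht).2 (subset_clF hBU heB)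
  have h5 := rkN_insert_eq_of_mem_sdiff_clF hG hBU ht'Z
  have := rkN_mono (M := M) hsub
  omega

open scoped Classical in
/-- **At most twelve pair preimages at a triangle** (under (H4)): with three distinct far preimages `B₁, B₂, B₃`
of the shadow set `S`, `#pairPre S ≤ 12`. -/
theorem card_pairPre_le_twelve_of_three_far {G : Finset α} (hG : G ∈ flatsQ M (4 + 1))
    (hd : (gr M \ G).card = 2) (h4 : ∀ C ⊆ G, C.card ≤ 4 → 3 ≤ rkN M (G \ C))
    {S : Finset α} (hS : S ∈ shadowAt M (4 + 2) 4 (Uq M (4 + 2) 4) G)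
    {B₁ B₂ B₃ : Finset α} (h₁ : B₁ ∈ opFarPre M G S) (h₂ : B₂ ∈ opFarPre M G S) (h₃ : B₃ ∈ opFarPre M G S)
    (h₁₂ : B₁ ≠ B₂) (h₁₃ : B₁ ≠ B₃) (h₂₃ : B₂ ≠ B₃) : (pairPre M 4 G S).card ≤ 12 := by
  have hGg : G ⊆ gr M := (mem_flatsQ.1 hG).1
  have hSG : S ⊆ G := subset_of_mem_shadowAt hS
  -- the triangle `T`, the rest `N = S ∖ T`, the plane `Π = G ∖ T`
  set T := (G \ clF M B₁) ∪ (G \ clF M B₂) ∪ (G \ clF M B₃) with hTdef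
  have hT3 : T.card = 3 := card_union_three_far_eq_three hG hd h4 h₁ h₂ h₃ h₁₂ h₁₃ h₂₃
  have hZ₁T : G \ clF M B₁ ⊆ T := Finset.subset_union_left.trans Finset.subset_union_left
  have hZ₂T : G \ clF M B₂ ⊆ T := Finset.subset_union_right.trans Finset.subset_union_left
  have hZ₃T : G \ clF M B₃ ⊆ T := Finset.subset_union_right
  have hTS : T ⊆ S := by
    intro e he
    rw [hTdef, Finset.mem_union, Finset.mem_union] at he
    rcases he with (he | he) | he
    · rw [← sdiff_eq_of_mem_opFarPre h₁] at he; exact (Finset.mem_sdiff.1 he).1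
    · rw [← sdiff_eq_of_mem_opFarPre h₂] at he; exact (Finset.mem_sdiff.1 he).1
    · rw [← sdiff_eq_of_mem_opFarPre h₃] at he; exact (Finset.mem_sdiff.1 he).1
  have hTG : T ⊆ G := hTS.trans hSG
  set N := S \ T with hNdef
  have hNG : N ⊆ G := Finset.sdiff_subset.trans hSG
  have hNg : N ⊆ gr M := hNG.trans hGg
  -- `ρ(Π) ≤ 3`
  have hPi : rkN M (G \ T) ≤ 3 := by
    have hsub : G \ T ⊆ clF M B₁ ∩ clF M B₂ := by
      intro e he
      exact Finset.mem_inter.2 ⟨sdiff_union_subset_clF (M := M) (B := B₁) hZ₁T he,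
        sdiff_union_subset_clF (M := M) (B := B₂) hZ₂T he⟩
    exact (rkN_mono (M := M) hsub).trans (rkN_inter_clF_le_three_of_opFarPre hG h₁ h₂ h₁₂)
  -- `ρ(N) = 3`
  have hN3 : rkN M N = 3 := by
    have hle : rkN M N ≤ 3 := by
      have : N ⊆ G \ T := by
        intro e he
        rw [hNdef, Finset.mem_sdiff] at he
        exact Finset.mem_sdiff.2 ⟨hSG he.1, he.2⟩
      exact (rkN_mono (M := M) this).trans hPi
    have hge : 3 ≤ rkN M N := by
      have hB₁U : B₁ ∈ Uq M (4 + 2) 4 := (mem_membersIn.1 (mem_opFarPre.1 h₁).1).1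
      have hr₁ := rkN_eq_of_mem_Uq hB₁U
      have hcard : (T \ (G \ clF M B₁)).card = 1 := by
        rw [Finset.card_sdiff, Finset.inter_eq_left.2 hZ₁T, hT3, (mem_opFarPre.1 h₁).2.1]
      have hsub : B₁ ⊆ N ∪ (T \ (G \ clF M B₁)) := by
        intro e he
        have heS : e ∈ S := subset_of_mem_opFarPre h₁ he
        rw [Finset.mem_union, hNdef, Finset.mem_sdiff, Finset.mem_sdiff]
        by_cases heT : e ∈ T
        · right
          refine ⟨heT, ?_⟩
          rw [← sdiff_eq_of_mem_opFarPre h₁, Finset.mem_sdiff]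
          exact fun h => h.2 he
        · left; exact ⟨heS, heT⟩
      have h1 := rkN_mono (M := M) hsub
      have h2 := rkN_union_le_rkN_add_card (M := M) N (T \ (G \ clF M B₁))
      rw [hcard] at h2
      omega
    omega
  -- every pair `P = S ∖ B'` of a pair preimage meets `T`
  have hmeet : ∀ B' ∈ pairPre M 4 G S, ∃ t ∈ S \ B', t ∈ T := by
    intro B' hB'
    obtain ⟨t, ht, ht'⟩ := Finset.not_subset.1 (not_sdiff_subset_inter_of_two_far hG hd h₁ h₂ h₁₂ hB')
    refine ⟨t, ht, ?_⟩
    have htG : t ∈ G := hSG (Finset.mem_sdiff.1 ht).1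
    rw [Finset.mem_inter] at ht'
    rw [hTdef, Finset.mem_union, Finset.mem_union, Finset.mem_sdiff, Finset.mem_sdiff]
    tauto
  -- a pair `{t, x}` with `x ∉ T` has `x` a coloop of `N`
  have hcol : ∀ B' ∈ pairPre M 4 G S, ∀ t ∈ S \ B', t ∈ T → ∀ x ∈ S \ B', x ∉ T → x ∈ coloops M N := by
    intro B' hB' t ht htT x hx hxT
    have hB'm : B' ∈ membersIn M (Uq M (4 + 2) 4) G := (mem_pairPre.1 hB').1
    have hB'U : B' ∈ Uq M (4 + 2) 4 := (mem_membersIn.1 hB'm).1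
    have hB'S : B' ⊆ S := subset_of_mem_pairPre hB'
    have hrB' := rkN_eq_of_mem_Uq hB'U
    have hP2 := card_sdiff_of_mem_pairPre hB'
    have htx : t ≠ x := fun h => hxT (h ▸ htT)
    have hP : S \ B' = {t, x} := by
      symm
      apply Finset.eq_of_subset_of_card_le
      · intro e he
        rw [Finset.mem_insert, Finset.mem_singleton] at he
        rcases he with rfl | rfl
        · exact ht
        · exact hx
      · rw [hP2, Finset.card_pair htx]
    have hxS : x ∈ S := (Finset.mem_sdiff.1 hx).1
    have hxN : x ∈ N := Finset.mem_sdiff.2 ⟨hxS, hxT⟩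
    -- `N ∖ x ⊆ B' ∩ Π`
    have hsub₁ : N.erase x ⊆ B' ∩ (G \ T) := by
      intro e he
      rw [Finset.mem_erase, hNdef, Finset.mem_sdiff] at he
      obtain ⟨hex, heS, heT⟩ := he
      rw [Finset.mem_inter, Finset.mem_sdiff]
      refine ⟨?_, hSG heS, heT⟩
      by_contra heB'
      have : e ∈ S \ B' := Finset.mem_sdiff.2 ⟨heS, heB'⟩
      rw [hP, Finset.mem_insert, Finset.mem_singleton] at this
      rcases this with rfl | rfl
      · exact heT htT
      · exact hex rfl
    -- `G ∖ t ⊆ B' ∪ Π`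
    have hsub₂ : G.erase t ⊆ B' ∪ (G \ T) := by
      intro e he
      rw [Finset.mem_erase] at he
      rw [Finset.mem_union, Finset.mem_sdiff]
      by_cases heT : e ∈ T
      · left
        by_contra heB'
        have : e ∈ S \ B' := Finset.mem_sdiff.2 ⟨hTS heT, heB'⟩
        rw [hP, Finset.mem_insert, Finset.mem_singleton] at this
        rcases this with rfl | rfl
        · exact he.1 rfl
        · exact hxT heT
      · right; exact ⟨he.2, heT⟩
    have h5 : 5 ≤ rkN M (G.erase t) := by
      rw [hTdef, Finset.mem_union, Finset.mem_union] at htT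
      rcases htT with (h | h) | h
      · exact five_le_rkN_erase_of_mem_sdiff_clF hG h₁ h
      · exact five_le_rkN_erase_of_mem_sdiff_clF hG h₂ h
      · exact five_le_rkN_erase_of_mem_sdiff_clF hG h₃ h
    have hsm := rkN_submod (M := M) B' (G \ T)
    have hm₁ := rkN_mono (M := M) hsub₁
    have hm₂ := rkN_mono (M := M) hsub₂
    have hNx : rkN M (N.erase x) ≤ 2 := by omega
    rw [mem_coloops]
    refine ⟨hxN, ?_⟩
    intro hxcl
    have hNcl : N ⊆ clF M (N.erase x) := by
      intro e he
      by_cases hex : e = x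
      · rw [hex]; exact hxcl
      · exact subset_clF_of_subset_gr (Finset.erase_subset _ _ |>.trans hNg) (Finset.mem_erase.2 ⟨hex, he⟩)
    have := rkN_le_of_subset_clF' (M := M) hNcl
    omega
  -- the injection `B' ↦ S ∖ B'` into the pairs inside `T` and the pairs `{t, x}`, `t ∈ T`, `x` a coloop of `N`
  have hmaps : ∀ B' ∈ pairPre M 4 G S, S \ B' ∈ Finset.powersetCard 2 T ∪
      (T ×ˢ coloops M N).image (fun p : α × α => ({p.1, p.2} : Finset α)) := by
    intro B' hB'
    rw [Finset.mem_union]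
    by_cases hPT : S \ B' ⊆ T
    · left
      rw [Finset.mem_powersetCard]
      exact ⟨hPT, card_sdiff_of_mem_pairPre hB'⟩
    · right
      obtain ⟨x, hx, hxT⟩ := Finset.not_subset.1 hPT
      obtain ⟨t, ht, htT⟩ := hmeet B' hB'
      have hxc := hcol B' hB' t ht htT x hx hxT
      have htx : t ≠ x := fun h => hxT (h ▸ htT)
      have hP : S \ B' = {t, x} := by
        symm
        apply Finset.eq_of_subset_of_card_le
        · intro e he
          rw [Finset.mem_insert, Finset.mem_singleton] at he
          rcases he with rfl | rfl
          · exact ht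
          · exact hx
        · rw [card_sdiff_of_mem_pairPre hB', Finset.card_pair htx]
      rw [Finset.mem_image]
      exact ⟨(t, x), Finset.mem_product.2 ⟨htT, hxc⟩, hP.symm⟩
  have hinj : Set.InjOn (fun B' => S \ B') (pairPre M 4 G S : Set (Finset α)) := by
    intro B hB B' hB' hBB'
    have h1 := subset_of_mem_pairPre (Finset.mem_coe.1 hB)
    have h2 := subset_of_mem_pairPre (Finset.mem_coe.1 hB')
    have h3 : S \ B = S \ B' := hBB'
    calc B = S \ (S \ B) := (Finset.sdiff_sdiff_eq_self h1).symm
      _ = S \ (S \ B') := by rw [h3]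
      _ = B' := Finset.sdiff_sdiff_eq_self h2
  have hcount := Finset.card_le_card_of_injOn (fun B' => S \ B') hmaps hinj
  have hcolN : (coloops M N).card ≤ 3 := by
    apply card_coloops_le hNg
    rw [eRk_eq_rkN, hN3]
  have hpow : (Finset.powersetCard 2 T).card = 3 := by
    rw [Finset.card_powersetCard, hT3]
    rfl
  have himg : ((T ×ˢ coloops M N).image (fun p : α × α => ({p.1, p.2} : Finset α))).card ≤ 9 := by
    refine Finset.card_image_le.trans ?_
    rw [Finset.card_product, hT3]
    omega
  have hun := Finset.card_union_le (Finset.powersetCard 2 T)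
    ((T ×ˢ coloops M N).image (fun p : α × α => ({p.1, p.2} : Finset α)))
  omega

end PercRepro.Shadow
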